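import Mathlib
import Summits.Ventures.HodgeRepro.Tier4.Line4.LevelTailInstance
import Summits.Ventures.HodgeRepro.Tier4.Line4.CentreFinDomain
import Summits.Ventures.HodgeRepro.Tier4.Line4.TorusProductHaar
import Summits.Ventures.HodgeRepro.Tier4.Line4.FinitePlacePositivity

/-!
# Tier4/Line4/FoldedUnfolded — C-L4-FOLDED-UNFOLDED: the folded support measure is at most a constant times the
unfolded one (the `Z(k)`-tiling connector between the RATIO display and the `hAv` block)

Blind re-derivation cell `pub-hodge-repro`, Tier 4 «prove the step» (README §9–§10), LINE L4, seat t4-x2 (g5, reserve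
wall-breaker; statement-first S15354 after plan-4 g5's C-L4-HAV-BLOCK S15269 and crit-2 Entry 256 (i) / S15346 (ii)).
Tree path `lean/Summits/Ventures/HodgeRepro/Tier4/Line4/FoldedUnfolded.lean`.  Imports `Line4/LevelTailInstance`
(p705148: `levelSuppSet`, `suppSetFolded_eq_inter`, `measure_restrict_prod_levelSuppSet`), `Line4/CentreFinDomain`
(p696615: `finTfHom`, `prodDomain`, `prodDomain_eq_preimage`, `isFundamentalDomain_prodDomain`),
`Line4/TorusProductHaar` (p696122: local compactness / second countability of `T_∞`, `T_f`), `Line4/FinitePlacePositivity`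
(p691079: `ofFinPart_mul`, `ofFinPart_inv`).  Mathlib-level; no literature; no `def`.

WHAT.  The RATIO display of record (`SuppMeasureComparisonAlong`, SuppMeasure p704106) speaks of the UNFOLDED support
measure `suppMeasure N γ = (ν_f ⊗ ν′_f)(suppSet γ ∩ DZ_f × T′_f)` on the finite parts, while the `hAv` block
(LevelTailHav) consumes the FOLDED one `suppMeasureFolded N γ = (μ_T ⊗ μ_{T′})(A_N γ)` on `D_T × D_{T′}`.  They live on
different spaces and the folded one is NOT a monotonicity consequence of the unfolded one: the connector is the
`Z(k)`-tiling of this module — `D_T` tiles the product domain `T_∞ × DZ_f` under the rational centre `Z(k)`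
(`isFundamentalDomain_prodDomain`, C-L4-ZDOMAIN), a central `z` moves through `γ` onto the `T′`-side, the `z`-translates
of `D_{T′}` are a.e. disjoint (`R.DT'_fund`), and the product measure of a set depending only on the finite parts is
`c c′ ν_∞(T_∞) ν′_∞(T′_∞)` times the `(ν_f ⊗ ν′_f)`-measure of its finite-part shadow (`hc`, `hc′`, `map_snd_prod`).

* `levelSuppSet_eq_preimage` — the level set is the preimage of `suppSet` under the finite-part projections
  `(t, t′) ↦ (t_f, t′_f)`; `prodDomain_prod_univ_inter_levelSuppSet` — with the product domain, the preimage of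
  `suppSet ∩ DZ_f × T′_f`.
* `map_finTf_eq` / `map_finTf'_eq` — the finite-part pushforward of `μ_T = c (ν_∞ ⊗ ν_f)` is `c ν_∞(T_∞) · ν_f`.
* `prod_apply_preimage_finPair` — `(μ_T ⊗ μ_{T′})((t_f, t′_f) ∈ S) = c c′ ν_∞(T_∞) ν′_∞(T′_∞) · (ν_f ⊗ ν′_f)(S)`.
* `suppMeasureFolded_le_prod_prodDomain` — THE TILING: `(μ_T ⊗ μ_{T′})(A_N γ) ≤ (μ_T ⊗ μ_{T′})((T_∞ × DZ_f) × T′ ∩ L_N γ)`.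
* **`suppMeasureFolded_le_suppMeasure`** — the connector:
  `suppMeasureFolded N γ ≤ (c c′ ν_∞(univ) ν′_∞(univ)) · suppMeasure N γ`, binders = HorbMain's chain data
  (`hc`, `hc′`, `hDZf`, `hfd`), at every `γ` and every level `N ≠ 0`.

Nothing here says anything about the status of the Hodge conjecture for CM abelian varieties, which is NOT proved
(HC_CM is NOT proved by anyone in this repository).
-/

set_option autoImplicit false

noncomputable section

namespace Summit.Ventures.HodgeRepro.Tier4.Line4

open MeasureTheory Summit.Ventures.HodgeRepro.Tier4 Summit.Ventures.HodgeRepro.Tier4.Common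
  Summit.Ventures.HodgeRepro.Tier4.Line1

open scoped ENNReal NNReal Pointwise

/-! ## 1. The level set as a preimage under the finite-part projections -/

section Sets

variable {k : Type} [Field k] [NumberField k] (W : PlaneData k)

/-- The level support set is the preimage of the unfolded support set under `(t, t′) ↦ (t_f, t′_f)`. -/
theorem levelSuppSet_eq_preimage (γ₀ : GA W) (N : ℕ) (γ : GA W) :
    levelSuppSet W γ₀ N γ = Prod.map (finTf W) (finTf' W) ⁻¹' suppSet W γ₀ N γ := by
  ext p
  simp only [levelSuppSet, suppSet, Set.mem_setOf_eq, Set.mem_preimage]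
  rw [ofFinPart_mul, ofFinPart_mul, ofFinPart_inv]
  exact Iff.rfl

/-- With the product domain `T_∞ × DZ_f` on the left factor: the preimage of `suppSet ∩ DZ_f × T′_f`. -/
theorem prodDomain_prod_univ_inter_levelSuppSet (DZf : Set (torusFin W)) (γ₀ : GA W) (N : ℕ) (γ : GA W) :
    prodDomain W DZf ×ˢ (Set.univ : Set (torusT' W)) ∩ levelSuppSet W γ₀ N γ =
      Prod.map (finTf W) (finTf' W) ⁻¹' (suppSet W γ₀ N γ ∩ DZf ×ˢ Set.univ) := by
  rw [levelSuppSet_eq_preimage, prodDomain_eq_preimage, Set.preimage_inter, Set.inter_comm]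
  rfl

end Sets

/-! ## 2. The finite-part pushforwards of the torus measures -/

section Pushforward

variable {k : Type} [Field k] [NumberField k] (W : PlaneData k) [MeasurableSpace (GA W)] [BorelSpace (GA W)]

/-- The finite-part pushforward of `μ_T = c · (ν_∞ ⊗ ν_f)` is `c ν_∞(T_∞) · ν_f`. -/
theorem map_finTf_eq (μT : Measure (torusT W)) (νinf : Measure (torusInf W)) [νinf.IsHaarMeasure]
    (νf : Measure (torusFin W)) [νf.IsHaarMeasure] (c : ℝ≥0)
    (hc : μT = c • Measure.map (torusSplit W).symm (νinf.prod νf)) :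
    Measure.map (finTf W) μT = ((c : ℝ≥0∞) * νinf Set.univ) • νf := by
  haveI := secondCountable_GA W
  haveI : BorelSpace (torusT W) := Subtype.borelSpace _
  haveI : BorelSpace (torusInf W) := Subtype.borelSpace _
  haveI : BorelSpace (torusFin W) := Subtype.borelSpace _
  haveI : SecondCountableTopology (torusInf W) := secondCountable_torusInf W
  haveI : SecondCountableTopology (torusFin W) := secondCountable_torusFin W
  haveI : LocallyCompactSpace (torusInf W) := locallyCompact_torusInf W
  haveI : LocallyCompactSpace (torusFin W) := locallyCompact_torusFin W
  haveI : IsLocallyFiniteMeasure νinf := isLocallyFiniteMeasure_of_isFiniteMeasureOnCompacts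
  haveI : IsLocallyFiniteMeasure νf := isLocallyFiniteMeasure_of_isFiniteMeasureOnCompacts
  haveI : SigmaFinite νinf := sigmaFinite_of_locallyFinite
  haveI : SigmaFinite νf := sigmaFinite_of_locallyFinite
  have hmeas : Measurable (finTf W) := (continuous_finTf W).measurable
  have hsymm : Measurable (torusSplit W).symm := (torusSplit W).symm.continuous.measurable
  have hcomp : finTf W ∘ (torusSplit W).symm = Prod.snd := by
    funext p
    exact congrArg Prod.snd ((torusSplit W).apply_symm_apply p)
  rw [hc, Measure.map_smul, Measure.map_map hmeas hsymm, hcomp, Measure.map_snd_prod]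
  ext s hs
  simp only [Measure.smul_apply, smul_eq_mul, ENNReal.smul_def, mul_assoc]

/-- The `T′` twin. -/
theorem map_finTf'_eq (μT' : Measure (torusT' W)) (νinf' : Measure (torusInf' W)) [νinf'.IsHaarMeasure]
    (νf' : Measure (torusFin' W)) [νf'.IsHaarMeasure] (c' : ℝ≥0)
    (hc' : μT' = c' • Measure.map (torusSplit' W).symm (νinf'.prod νf')) :
    Measure.map (finTf' W) μT' = ((c' : ℝ≥0∞) * νinf' Set.univ) • νf' := by
  haveI := secondCountable_GA W
  haveI : BorelSpace (torusT' W) := Subtype.borelSpace _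
  haveI : BorelSpace (torusInf' W) := Subtype.borelSpace _
  haveI : BorelSpace (torusFin' W) := Subtype.borelSpace _
  haveI : SecondCountableTopology (torusInf' W) := secondCountable_torusInf' W
  haveI : SecondCountableTopology (torusFin' W) := secondCountable_torusFin' W
  haveI : LocallyCompactSpace (torusInf' W) := locallyCompact_torusInf' W
  haveI : LocallyCompactSpace (torusFin' W) := locallyCompact_torusFin' W
  haveI : IsLocallyFiniteMeasure νinf' := isLocallyFiniteMeasure_of_isFiniteMeasureOnCompacts
  haveI : IsLocallyFiniteMeasure νf' := isLocallyFiniteMeasure_of_isFiniteMeasureOnCompacts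
  haveI : SigmaFinite νinf' := sigmaFinite_of_locallyFinite
  haveI : SigmaFinite νf' := sigmaFinite_of_locallyFinite
  have hmeas : Measurable (finTf' W) := (continuous_finTf' W).measurable
  have hsymm : Measurable (torusSplit' W).symm := (torusSplit' W).symm.continuous.measurable
  have hcomp : finTf' W ∘ (torusSplit' W).symm = Prod.snd := by
    funext p
    exact congrArg Prod.snd ((torusSplit' W).apply_symm_apply p)
  rw [hc', Measure.map_smul, Measure.map_map hmeas hsymm, hcomp, Measure.map_snd_prod]
  ext s hs
  simp only [Measure.smul_apply, smul_eq_mul, ENNReal.smul_def, mul_assoc]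

/-- **The product measure of a finite-part condition**: for a measurable `S ⊆ T_f × T′_f`,
`(μ_T ⊗ μ_{T′})({(t, t′) : (t_f, t′_f) ∈ S}) = c c′ ν_∞(T_∞) ν′_∞(T′_∞) · (ν_f ⊗ ν′_f)(S)`. -/
theorem prod_apply_preimage_finPair (R : RTFData W) (hR : R.IsHaar)
    (νinf : Measure (torusInf W)) [νinf.IsHaarMeasure] (νf : Measure (torusFin W)) [νf.IsHaarMeasure]
    (c : ℝ≥0) (hc : R.μT = c • Measure.map (torusSplit W).symm (νinf.prod νf))
    (νinf' : Measure (torusInf' W)) [νinf'.IsHaarMeasure] (νf' : Measure (torusFin' W)) [νf'.IsHaarMeasure]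
    (c' : ℝ≥0) (hc' : R.μT' = c' • Measure.map (torusSplit' W).symm (νinf'.prod νf'))
    {S : Set (torusFin W × torusFin' W)} (hS : MeasurableSet S) :
    (R.μT.prod R.μT') (Prod.map (finTf W) (finTf' W) ⁻¹' S) =
      ((c : ℝ≥0∞) * νinf Set.univ * ((c' : ℝ≥0∞) * νinf' Set.univ)) * (νf.prod νf') S := by
  haveI : R.μT.IsHaarMeasure := hR.1
  haveI : R.μT'.IsHaarMeasure := hR.2.1
  haveI := secondCountable_GA W
  haveI : LocallyCompactSpace (torusT W) := locallyCompact_torusT W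
  haveI : LocallyCompactSpace (torusT' W) := locallyCompactSpace_torusT' W
  haveI : SecondCountableTopology (torusT W) := secondCountable_torusT W
  haveI : SecondCountableTopology (torusT' W) :=
    TopologicalSpace.Subtype.secondCountableTopology (torusT' W : Set (GA W))
  haveI : BorelSpace (torusT W) := Subtype.borelSpace _
  haveI : BorelSpace (torusT' W) := Subtype.borelSpace _
  haveI : BorelSpace (torusFin W) := Subtype.borelSpace _
  haveI : BorelSpace (torusFin' W) := Subtype.borelSpace _
  haveI : IsLocallyFiniteMeasure R.μT := isLocallyFiniteMeasure_of_isFiniteMeasureOnCompacts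
  haveI : IsLocallyFiniteMeasure R.μT' := isLocallyFiniteMeasure_of_isFiniteMeasureOnCompacts
  haveI : SigmaFinite R.μT := sigmaFinite_of_locallyFinite
  haveI : SigmaFinite R.μT' := sigmaFinite_of_locallyFinite
  haveI : SecondCountableTopology (torusFin W) := secondCountable_torusFin W
  haveI : SecondCountableTopology (torusFin' W) := secondCountable_torusFin' W
  haveI : LocallyCompactSpace (torusFin W) := locallyCompact_torusFin W
  haveI : LocallyCompactSpace (torusFin' W) := locallyCompact_torusFin' W
  haveI : IsLocallyFiniteMeasure νf := isLocallyFiniteMeasure_of_isFiniteMeasureOnCompacts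
  haveI : IsLocallyFiniteMeasure νf' := isLocallyFiniteMeasure_of_isFiniteMeasureOnCompacts
  haveI : SigmaFinite νf := sigmaFinite_of_locallyFinite
  haveI : SigmaFinite νf' := sigmaFinite_of_locallyFinite
  have hmeas : Measurable (finTf W) := (continuous_finTf W).measurable
  have hmeas' : Measurable (finTf' W) := (continuous_finTf' W).measurable
  rw [← Measure.map_apply (hmeas.prodMap hmeas') hS, ← Measure.map_prod_map _ _ hmeas hmeas',
    map_finTf_eq W R.μT νinf νf c hc, map_finTf'_eq W R.μT' νinf' νf' c' hc', Measure.prod_smul_left,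
    Measure.prod_smul_right, Measure.smul_apply, Measure.smul_apply, smul_eq_mul, smul_eq_mul]
  ring

end Pushforward

/-! ## 3. The tiling: the folded measure is at most the product measure over `(T_∞ × DZ_f) × T′` -/

section Tiling

variable {k : Type} [Field k] [NumberField k] (W : PlaneData k)

/-- `centreInT'` is injective (the same adelic element). -/
theorem centreInT'_injective : Function.Injective (centreInT' W) := by
  intro z₁ z₂ h
  have h1 := congrArg (fun x : rationalOf W (torusT' W) => ((x : torusT' W) : GA W)) h
  simp only [centreInT'_coe] at h1
  exact Subtype.ext (Subtype.ext h1)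

/-- A central rational `z` moves from the `T`-side to the `T′`-side of a section of the level set:
`z • {t : (t, t′) ∈ L} = {s : (s, z t′) ∈ L}`. -/
theorem smul_preimage_levelSuppSet (γ₀ : GA W) (N : ℕ) (γ : GA W) (z : rationalCentreT W) (t' : torusT' W) :
    z • ((fun t : torusT W => (t, t')) ⁻¹' levelSuppSet W γ₀ N γ) =
      (fun s : torusT W => (s, (centreInT' W z : torusT' W) * t')) ⁻¹' levelSuppSet W γ₀ N γ := by
  ext s
  rw [Set.mem_smul_set_iff_inv_smul_mem]
  simp only [Set.mem_preimage, levelSuppSet, Set.mem_setOf_eq]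
  have hz : ((z⁻¹ • s : torusT W) : GA W) = ((z : torusT W) : GA W)⁻¹ * (s : GA W) := by
    rw [Submonoid.smul_def, smul_eq_mul, Subgroup.coe_mul, Subgroup.coe_inv, Subgroup.coe_inv]
  have hz' : (((centreInT' W z : torusT' W) * t' : torusT' W) : GA W) =
      ((z : torusT W) : GA W) * (t' : GA W) := by
    rw [Subgroup.coe_mul, centreInT'_coe]
  have hcomm : γ * ((z : torusT W) : GA W) = ((z : torusT W) : GA W) * γ := rationalCentreT.comm W z.2 γ
  rw [hz, hz', mul_inv_rev, inv_inv, mul_assoc ((s : GA W)⁻¹), ← hcomm]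
  simp only [mul_assoc]

variable [MeasurableSpace (GA W)] [BorelSpace (GA W)] (R : RTFData W)

/-- **THE `Z(k)`-TILING**: the folded support measure `(μ_T ⊗ μ_{T′})(A_N γ)` (on `D_T × D_{T′}`) is at most the
`(μ_T ⊗ μ_{T′})`-measure of `((T_∞ × DZ_f) × T′) ∩ L_N γ` — `D_T` tiles `T_∞ × DZ_f` under the rational centre
(`isFundamentalDomain_prodDomain`), a central `z` moves through `γ` onto the `T′`-side, and the `z`-translates of
`D_{T′}` are a.e. disjoint (`R.DT'_fund`). -/
theorem suppMeasureFolded_le_prod_prodDomain [MeasurableMul (torusT W)] [MeasurableMul (torusT' W)]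
    (hR : R.IsHaar) (νinf : Measure (torusInf W)) [νinf.IsHaarMeasure] (νf : Measure (torusFin W))
    [νf.IsHaarMeasure] (c : ℝ≥0) (hc : R.μT = c • Measure.map (torusSplit W).symm (νinf.prod νf))
    (DZf : Set (torusFin W)) (hDZf : MeasurableSet DZf) (hfd : IsFundamentalDomain (centreFin W) DZf νf)
    (γ₀ : GA W) {N : ℕ} (hN : N ≠ 0) (γ : GA W) :
    suppMeasureFolded W R γ₀ N γ ≤
      (R.μT.prod R.μT') (prodDomain W DZf ×ˢ (Set.univ : Set (torusT' W)) ∩ levelSuppSet W γ₀ N γ) := by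
  haveI : R.μT.IsHaarMeasure := hR.1
  haveI : R.μT'.IsHaarMeasure := hR.2.1
  haveI := secondCountable_GA W
  haveI : LocallyCompactSpace (torusT W) := locallyCompact_torusT W
  haveI : LocallyCompactSpace (torusT' W) := locallyCompactSpace_torusT' W
  haveI : SecondCountableTopology (torusT W) := secondCountable_torusT W
  haveI : SecondCountableTopology (torusT' W) :=
    TopologicalSpace.Subtype.secondCountableTopology (torusT' W : Set (GA W))
  haveI : BorelSpace (torusT W) := Subtype.borelSpace _
  haveI : BorelSpace (torusT' W) := Subtype.borelSpace _
  haveI : BorelSpace (torusFin W) := Subtype.borelSpace _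
  haveI : IsLocallyFiniteMeasure R.μT := isLocallyFiniteMeasure_of_isFiniteMeasureOnCompacts
  haveI : IsLocallyFiniteMeasure R.μT' := isLocallyFiniteMeasure_of_isFiniteMeasureOnCompacts
  haveI : SigmaFinite R.μT := sigmaFinite_of_locallyFinite
  haveI : SigmaFinite R.μT' := sigmaFinite_of_locallyFinite
  haveI hcZ : Countable (rationalCentreT W) := countable_rationalCentreT W
  haveI : R.μT.IsMulLeftInvariant := hR.1.toIsMulLeftInvariant
  haveI : R.μT'.IsMulLeftInvariant := hR.2.1.toIsMulLeftInvariant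
  haveI : SMulInvariantMeasure (torusT W) (torusT W) R.μT := ⟨fun c _ _ => measure_preimage_mul R.μT c _⟩
  haveI : SMulInvariantMeasure (rationalCentreT W) (torusT W) R.μT := Subgroup.smulInvariantMeasure _
  haveI : MeasurableConstSMul (torusT W) (torusT W) := ⟨fun c => measurable_const_mul c⟩
  haveI : MeasurableConstSMul (rationalCentreT W) (torusT W) := Subgroup.instMeasurableConstSMul _
  have hL : MeasurableSet (levelSuppSet W γ₀ N γ) := measurableSet_levelSuppSet W γ₀ hN γ
  have hP : MeasurableSet (prodDomain W DZf) := by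
    rw [prodDomain_eq_preimage]
    exact hDZf.preimage (continuous_finTfHom W).measurable
  have hfdP : IsFundamentalDomain (rationalCentreT W) (prodDomain W DZf) R.μT :=
    isFundamentalDomain_prodDomain W νinf νf R.μT c hc DZf hfd
  have hB : MeasurableSet (prodDomain W DZf ×ˢ (Set.univ : Set (torusT' W)) ∩ levelSuppSet W γ₀ N γ) :=
    (hP.prod MeasurableSet.univ).inter hL
  have hgm : Measurable fun u : torusT' W => R.μT ((fun s : torusT W => (s, u)) ⁻¹'
      (prodDomain W DZf ×ˢ (Set.univ : Set (torusT' W)) ∩ levelSuppSet W γ₀ N γ)) :=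
    measurable_measure_prodMk_right hB
  -- Step A: Fubini on the restricted product measure
  rw [← measure_restrict_prod_levelSuppSet W R hR γ₀ hN γ, Measure.prod_apply_symm hL,
    Measure.prod_apply_symm hB]
  -- Step B: one section, tiled by `Z(k)`
  have hsec : ∀ t' : torusT' W,
      (R.μT.restrict R.DT) ((fun t : torusT W => (t, t')) ⁻¹' levelSuppSet W γ₀ N γ) ≤
        ∑' z : rationalCentreT W, R.μT ((fun s : torusT W => (s, (centreInT' W z : torusT' W) * t')) ⁻¹'
          (prodDomain W DZf ×ˢ (Set.univ : Set (torusT' W)) ∩ levelSuppSet W γ₀ N γ)) := by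
    intro t'
    rw [Measure.restrict_apply (hL.preimage measurable_prodMk_right), hfdP.measure_eq_tsum]
    refine ENNReal.tsum_le_tsum fun z => measure_mono ?_
    intro s hs
    obtain ⟨hs1, hs2⟩ := hs
    have hs3 : s ∈ z • ((fun t : torusT W => (t, t')) ⁻¹' levelSuppSet W γ₀ N γ) :=
      Set.smul_set_mono Set.inter_subset_left hs1
    rw [smul_preimage_levelSuppSet] at hs3
    exact ⟨⟨hs2, Set.mem_univ _⟩, hs3⟩
  -- Step C: integrate over `D_{T′}`, move each `z` to the translate `z • D_{T′}`, tile `T′`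
  have hDT' : NullMeasurableSet R.DT' R.μT' := R.DT'_fund.nullMeasurableSet
  have hzDT' : ∀ z : rationalCentreT W, NullMeasurableSet ((centreInT' W z) • R.DT') R.μT' :=
    fun z => R.DT'_fund.nullMeasurableSet_smul (centreInT' W z)
  have hdisj : Pairwise (Function.onFun (AEDisjoint R.μT') fun z : rationalCentreT W => (centreInT' W z) • R.DT') :=
    fun _ _ hne => R.DT'_fund.aedisjoint fun h => hne (centreInT'_injective W h)
  have hcov : ∀ z : rationalCentreT W,
      ∫⁻ t' in R.DT', R.μT ((fun s : torusT W => (s, (centreInT' W z : torusT' W) * t')) ⁻¹'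
          (prodDomain W DZf ×ˢ (Set.univ : Set (torusT' W)) ∩ levelSuppSet W γ₀ N γ)) ∂(R.μT') =
        ∫⁻ u in (centreInT' W z) • R.DT', R.μT ((fun s : torusT W => (s, u)) ⁻¹'
          (prodDomain W DZf ×ˢ (Set.univ : Set (torusT' W)) ∩ levelSuppSet W γ₀ N γ)) ∂(R.μT') := by
    intro z
    rw [← lintegral_indicator₀ hDT', ← lintegral_indicator₀ (hzDT' z)]
    have hpt : ∀ t' : torusT' W,
        R.DT'.indicator (fun t' : torusT' W => R.μT ((fun s : torusT W => (s, (centreInT' W z : torusT' W) * t')) ⁻¹'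
          (prodDomain W DZf ×ˢ (Set.univ : Set (torusT' W)) ∩ levelSuppSet W γ₀ N γ))) t' =
        ((centreInT' W z) • R.DT').indicator (fun u : torusT' W => R.μT ((fun s : torusT W => (s, u)) ⁻¹'
          (prodDomain W DZf ×ˢ (Set.univ : Set (torusT' W)) ∩ levelSuppSet W γ₀ N γ)))
          ((centreInT' W z : torusT' W) * t') := by
      intro t'
      by_cases ht : t' ∈ R.DT'
      · have hmem : (centreInT' W z : torusT' W) * t' ∈ (centreInT' W z) • R.DT' := Set.smul_mem_smul_set ht
        rw [Set.indicator_of_mem ht, Set.indicator_of_mem hmem]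
      · have hmem : (centreInT' W z : torusT' W) * t' ∉ (centreInT' W z) • R.DT' := fun h =>
          ht (Set.smul_mem_smul_set_iff.1 h)
        rw [Set.indicator_of_notMem ht, Set.indicator_of_notMem hmem]
    simp_rw [hpt]
    exact lintegral_mul_left_eq_self _ _
  calc ∫⁻ t', (R.μT.restrict R.DT) ((fun t : torusT W => (t, t')) ⁻¹' levelSuppSet W γ₀ N γ)
        ∂(R.μT'.restrict R.DT')
      ≤ ∫⁻ t', ∑' z : rationalCentreT W, R.μT ((fun s : torusT W => (s, (centreInT' W z : torusT' W) * t')) ⁻¹'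
          (prodDomain W DZf ×ˢ (Set.univ : Set (torusT' W)) ∩ levelSuppSet W γ₀ N γ)) ∂(R.μT'.restrict R.DT') :=
        lintegral_mono hsec
    _ = ∑' z : rationalCentreT W, ∫⁻ t' in R.DT', R.μT ((fun s : torusT W => (s, (centreInT' W z : torusT' W) * t')) ⁻¹'
          (prodDomain W DZf ×ˢ (Set.univ : Set (torusT' W)) ∩ levelSuppSet W γ₀ N γ)) ∂(R.μT') :=
        lintegral_tsum fun z => (hgm.comp (measurable_const_mul (centreInT' W z : torusT' W))).aemeasurable
    _ = ∑' z : rationalCentreT W, ∫⁻ u in (centreInT' W z) • R.DT', R.μT ((fun s : torusT W => (s, u)) ⁻¹'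
          (prodDomain W DZf ×ˢ (Set.univ : Set (torusT' W)) ∩ levelSuppSet W γ₀ N γ)) ∂(R.μT') :=
        tsum_congr hcov
    _ = ∫⁻ u in ⋃ z : rationalCentreT W, (centreInT' W z) • R.DT', R.μT ((fun s : torusT W => (s, u)) ⁻¹'
          (prodDomain W DZf ×ˢ (Set.univ : Set (torusT' W)) ∩ levelSuppSet W γ₀ N γ)) ∂(R.μT') :=
        (lintegral_iUnion₀ hzDT' hdisj _).symm
    _ ≤ ∫⁻ u, R.μT ((fun s : torusT W => (s, u)) ⁻¹'
          (prodDomain W DZf ×ˢ (Set.univ : Set (torusT' W)) ∩ levelSuppSet W γ₀ N γ)) ∂(R.μT') :=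
        setLIntegral_le_lintegral _ _

end Tiling

/-! ## 4. The connector -/

section Connector

variable {k : Type} [Field k] [NumberField k] (W : PlaneData k) [MeasurableSpace (GA W)] [BorelSpace (GA W)]
  (R : RTFData W)

/-- **C-L4-FOLDED-UNFOLDED**: the folded support measure is at most `c c′ ν_∞(T_∞) ν′_∞(T′_∞)` times the unfolded one,
at every rational point `γ` and every level `N ≠ 0`; binders = HorbMain's chain data (`hc`, `hc′`, `hDZf`, `hfd`). -/
theorem suppMeasureFolded_le_suppMeasure [MeasurableMul (torusT W)] [MeasurableMul (torusT' W)]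
    (hR : R.IsHaar) (νinf : Measure (torusInf W)) [νinf.IsHaarMeasure] (νf : Measure (torusFin W))
    [νf.IsHaarMeasure] (c : ℝ≥0) (hc : R.μT = c • Measure.map (torusSplit W).symm (νinf.prod νf))
    (νinf' : Measure (torusInf' W)) [νinf'.IsHaarMeasure] (νf' : Measure (torusFin' W)) [νf'.IsHaarMeasure]
    (c' : ℝ≥0) (hc' : R.μT' = c' • Measure.map (torusSplit' W).symm (νinf'.prod νf'))
    (DZf : Set (torusFin W)) (hDZf : MeasurableSet DZf) (hfd : IsFundamentalDomain (centreFin W) DZf νf)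
    (γ₀ : GA W) {N : ℕ} (hN : N ≠ 0) (γ : GA W) :
    suppMeasureFolded W R γ₀ N γ ≤
      ((c : ℝ≥0∞) * νinf Set.univ * ((c' : ℝ≥0∞) * νinf' Set.univ)) * suppMeasure W νf νf' γ₀ DZf N γ := by
  haveI : BorelSpace (torusFin W) := Subtype.borelSpace _
  haveI : BorelSpace (torusFin' W) := Subtype.borelSpace _
  have hS : MeasurableSet (suppSet W γ₀ N γ ∩ DZf ×ˢ (Set.univ : Set (torusFin' W))) :=
    (measurableSet_suppSet W γ₀ hN γ).inter (hDZf.prod MeasurableSet.univ)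
  refine (suppMeasureFolded_le_prod_prodDomain W R hR νinf νf c hc DZf hDZf hfd γ₀ hN γ).trans (le_of_eq ?_)
  rw [prodDomain_prod_univ_inter_levelSuppSet, prod_apply_preimage_finPair W R hR νinf νf c hc νinf' νf' c' hc' hS]
  rfl

end Connector

end Summit.Ventures.HodgeRepro.Tier4.Line4

end
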